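import Literature.Barriers.Parity.SiegelZeroDichotomyProofs
import Literature.NumberTheory.LFunctions.DirichletRealCharacterStarkBox
import HarnessLib

/-!
# A Siegel zero (Tao–Teräväinen, Def. 1.4) is SIMPLE, its quality is WELL DEFINED, and it is the
# only zero of its `L`-function in Stark's box — kernel facts for the predicate `IsSiegelZero`

Topic `Literature/Barriers/Parity` (namespace `Literature.Barriers.Parity`, dot-lemmas on the tree's
predicate `IsSiegelZero χ η` of `SiegelZeroDichotomy.lean`: `χ` primitive quadratic mod `q`,
`η ≥ 10`, `L(1 − 1/(η log q), χ) = 0`). PROOF-ONLY module (D-0014/D-0026, kernel lane): theorems,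
no definitions, no named facts, no new barrier. Cell `landau-siegel` §C (typer pool), OFFER-F
2026-08-27; vocabulary service for the Parity summit's barrier files and the illusory-world inventory.

Source of the mathematics: Hoffstein 1980 Lemma 2 (= Chen 2007 Lemma 1, exact constant `6 − 4√2`)
and Stark 1974 Lemma 3, PROVED in the tree for number fields and transported to real primitive
Dirichlet characters in `Literature/NumberTheory/LFunctions/DirichletRealZeroHoffsteinWindow.lean` /
`DirichletRealCharacterStarkBox.lean`. A Siegel zero `β = 1 − 1/(η log q)` of quality `η ≥ 10`
lies in Hoffstein's window `1 − β < (6 − 4√2)/log q` (as `1/η ≤ 1/10 < 0.343…`) and in Stark's box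
`Re ≥ 1 − 1/(4 log q)` (as `η ≥ 4`). Hence:

* `IsSiegelZero.simple` — `ord_{s=β} L(s, χ) = 1`;
* `IsSiegelZero.eta_unique` — `IsSiegelZero χ η → IsSiegelZero χ η' → η = η'` (two real zeros of
  `L(s, χ)` of quality `> 3/2 + √2 = 2.914…` coincide: the quality of a character's Siegel zero is a
  well-defined number);
* `IsSiegelZero.realZero_le` — every OTHER real zero `β'` of `L(s, χ)` has
  `β' ≤ 1 − (6 − 4√2)/log q` (quality `≤ 3/2 + √2 < 3`);
* `IsSiegelZero.eq_of_mem_starkBox` — every zero `ρ` of `L(s, χ)` (complex ones included) with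
  `Re ρ ≥ 1 − 1/(4 log q)`, `|Im ρ| ≤ 1/(4 log q)` IS the Siegel zero.

[cite: TaoTeravainen2021, Definition 1.4] [cite: Hoffstein1980SiegelTatuzawa, Lemma 2 p. 169]
[cite: Chen2007SiegelTatuzawaHoffstein, Lemma 1 p. 362] [cite: Stark1974, Lemma 3]

«The programme SEARCHES and TYPES; no claim about Landau–Siegel zeros, Theorems 1–2 of
arXiv:2211.02515 or a repaired Margin232 until a kernel theorem says so.»
-/

noncomputable section

open Literature.NumberTheory.LFunctions

namespace Literature.Barriers.Parity

variable {q : ℕ} [NeZero q] {χ : DirichletCharacter ℂ q} {η : ℝ}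

/-- The character of a Siegel zero is not principal (conductor `q ≥ 3`).
[cite: TaoTeravainen2021, Definition 1.4] -/
private theorem IsSiegelZero.ne_one' (h : IsSiegelZero χ η) : χ ≠ 1 := by
  intro h1
  have hq := h.three_le
  have hcond : χ.conductor = q := h.1
  rw [h1, DirichletCharacter.conductor_one] at hcond
  omega

/-- A Siegel zero `β = 1 − 1/(η log q)` (quality `η ≥ 10`) lies in Hoffstein's window:
`1 − β = 1/(η log q) < (6 − 4√2)/log q` (as `log q ≥ log 3 > 0` and `1/η ≤ 1/10 < 6 − 4√2`).
[cite: Hoffstein1980SiegelTatuzawa, Lemma 2 p. 169] [cite: TaoTeravainen2021, Definition 1.4] -/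
theorem IsSiegelZero.hoffsteinWindow (h : IsSiegelZero χ η) :
    1 - (1 - 1 / (η * Real.log q)) < (6 - 4 * Real.sqrt 2) / Real.log q := by
  have hq3 : (3 : ℝ) ≤ q := by exact_mod_cast h.three_le
  have hlog : 1 < Real.log (q : ℝ) := by
    rw [← Real.log_exp 1]
    refine Real.log_lt_log (Real.exp_pos 1) ?_
    have := Real.exp_one_lt_d9
    linarith
  have hη := h.ten_le
  obtain ⟨hc1, -⟩ := NumberField.chenConst_bounds
  have hηlog : 0 < η * Real.log q := by positivity
  rw [sub_sub_cancel, div_lt_div_iff₀ hηlog (by linarith)]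
  -- `log q < (6 − 4√2) η log q` since `(6 − 4√2) η ≥ 3.4 > 1`
  nlinarith

/-- **A Siegel zero is a simple zero of `L(s, χ)`.** (Hoffstein's Lemma 2 / Chen's Lemma 1 on the
quadratic field of `χ`: a real zero in the window `1 − β < (6 − 4√2)/log q` is simple.)
[cite: Hoffstein1980SiegelTatuzawa, Lemma 2 p. 169] [cite: Chen2007SiegelTatuzawaHoffstein, Lemma 1 p. 362]
[cite: TaoTeravainen2021, Definition 1.4] -/
theorem IsSiegelZero.simple (h : IsSiegelZero χ η) :
    analyticOrderAt χ.LFunction ((1 - 1 / (η * Real.log q) : ℝ) : ℂ) = 1 :=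
  realZero_hoffsteinWindow_simple h.1 h.2.1 h.ne_one' h.2.2.2 h.hoffsteinWindow

/-- **The quality of a Siegel zero is well defined**: if `χ` has Siegel zeros of qualities `η` and
`η'`, then `η = η'` (both real zeros lie in Hoffstein's window, where `L(s, χ)` has at most one real
zero). [cite: Hoffstein1980SiegelTatuzawa, Lemma 2 p. 169] [cite: TaoTeravainen2021, Definition 1.4] -/
theorem IsSiegelZero.eta_unique {η' : ℝ} (h : IsSiegelZero χ η) (h' : IsSiegelZero χ η') : η = η' := by
  have hq3 : (3 : ℝ) ≤ q := by exact_mod_cast h.three_le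
  have hlog : 0 < Real.log (q : ℝ) := Real.log_pos (by linarith)
  have hη : 0 < η := by linarith [h.ten_le]
  have hη' : 0 < η' := by linarith [h'.ten_le]
  have hββ : (1 - 1 / (η * Real.log q) : ℝ) = 1 - 1 / (η' * Real.log q) :=
    HoffsteinWindow.realZeros_subsingleton h.1 h.2.1 h.ne_one'
      ⟨h.2.2.2, h.hoffsteinWindow⟩ ⟨h'.2.2.2, h'.hoffsteinWindow⟩
  have h1 : η * Real.log q = η' * Real.log q := by
    have hne : η * Real.log q ≠ 0 := by positivity
    have hne' : η' * Real.log q ≠ 0 := by positivity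
    have := sub_right_injective hββ
    rwa [one_div, one_div, inv_inj] at this
  exact mul_right_cancel₀ hlog.ne' h1

/-- **Every other real zero is far from `1`**: if `χ` has a Siegel zero `β = 1 − 1/(η log q)` and
`β' ≠ β` is a real zero of `L(s, χ)`, then `β' ≤ 1 − (6 − 4√2)/log q` (quality `≤ 3/2 + √2 < 3`).
[cite: Hoffstein1980SiegelTatuzawa, Lemma 2 p. 169] [cite: TaoTeravainen2021, Definition 1.4] -/
theorem IsSiegelZero.realZero_le (h : IsSiegelZero χ η) {β' : ℝ} (hz : χ.LFunction β' = 0)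
    (hne : β' ≠ 1 - 1 / (η * Real.log q)) : β' ≤ 1 - (6 - 4 * Real.sqrt 2) / Real.log q := by
  have hmin := min_realZeros_le_of_isPrimitive h.1 h.2.1 h.ne_one' hne hz h.2.2.2
  have hβ : 1 - (6 - 4 * Real.sqrt 2) / Real.log q < 1 - 1 / (η * Real.log q) := by
    linarith [h.hoffsteinWindow]
  refine not_lt.mp fun hlt => ?_
  have : 1 - (6 - 4 * Real.sqrt 2) / Real.log q < min β' (1 - 1 / (η * Real.log q)) :=
    lt_min hlt hβ
  linarith

/-- **The Siegel zero is the only zero of `L(s, χ)` in Stark's box** `Re ρ ≥ 1 − 1/(4 log q)`,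
`|Im ρ| ≤ 1/(4 log q)` — complex zeros included (Stark 1974 Lemma 3 on the quadratic field of `χ`;
the Siegel zero itself lies in the box since `η ≥ 10 ≥ 4`). [cite: Stark1974, Lemma 3]
[cite: TaoTeravainen2021, Definition 1.4] -/
theorem IsSiegelZero.eq_of_mem_starkBox (h : IsSiegelZero χ η) {ρ : ℂ} (hz : χ.LFunction ρ = 0)
    (hρ : ρ ∈ NumberField.starkBox (q : ℝ)) : ρ = ((1 - 1 / (η * Real.log q) : ℝ) : ℂ) := by
  have hq3 : (3 : ℝ) ≤ q := by exact_mod_cast h.three_le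
  have hlog : 0 < Real.log (q : ℝ) := Real.log_pos (by linarith)
  have hη := h.ten_le
  -- the Siegel zero lies in Stark's box: `1 − 1/(4 log q) ≤ 1 − 1/(η log q)`
  have hβbox : ((1 - 1 / (η * Real.log q) : ℝ) : ℂ) ∈ NumberField.starkBox (q : ℝ) := by
    refine NumberField.ofReal_mem_starkBox (by linarith) ?_
    have : 1 / (η * Real.log q) ≤ 1 / (4 * Real.log q) :=
      one_div_le_one_div_of_le (by positivity) (by nlinarith)
    linarith
  obtain ⟨hsub, -⟩ := starkBox_realCharacter h.1 h.2.1 h.ne_one'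
  exact hsub ⟨hz, hρ⟩ ⟨h.2.2.2, hβbox⟩

end Literature.Barriers.Parity
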